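import Mathlib.NumberTheory.PrimeCounting
import Mathlib.NumberTheory.ArithmeticFunction.Moebius
import Mathlib.Analysis.SpecialFunctions.Log.Basic
import HarnessLib

/-!
# Route `PrimeLevelFamEdge`, crux K_A `MomentsBeyondDiagonal` (stmt-Parity-20007), line «petersson_layers» v4, stub `stub_diag`:
# **the `P₂`-twisted Möbius harmonic sum `Σ_{d ≤ N} μ(d)P₂(d)/d`: exact splitting at `√N`** (combinatorial skeleton of L3)

Third brick (L3, combinatorial half) of the (P2TAIL) chain toward the order-`(2,2)` remainder estimate of `stub_diag` (plan:
`Cruxes/MomentsBeyondDiagonal/Lines/petersson_layers_stub_diag_g12_R02_R22.md`). With `P₂(d) = Σ_{p ∣ d} log²p`,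
`m_p(Z) = Σ_{m ≤ Z, (m,p)=1} μ(m)/m`, `m(Z) = Σ_{m ≤ Z} μ(m)/m`, `S(M) = Σ_{p ≤ M} log²p/p`, `K = ⌊√N⌋`:

* `sum_moebius_primeSq_div_eq` — `Σ_{d ≤ N} μ(d)P₂(d)/d = −Σ_{p ≤ N} (log²p/p)·m_p(⌊N/p⌋)` (swap `Σ_dΣ_{p∣d}`, `d = pm`,
  `μ(pm) = −μ(m)·1_{p∤m}`);
* `filter_coprime_Icc_div_eq` — for `N/p < p` the coprimality condition is void: `m_p(⌊N/p⌋) = m(⌊N/p⌋)`;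
* `sum_large_primes_swap` — `Σ_{K<p≤N} (log²p/p)·m(⌊N/p⌋) = Σ_{k ≤ K} (μ(k)/k)·(S(⌊N/k⌋) − S(K))` (`K² ≤ N < (K+1)²`);
* `sum_moebius_primeSq_div_split` — **`Σ_{d ≤ N} μ(d)P₂(d)/d = −Σ_{p ≤ K}(log²p/p)·m_p(⌊N/p⌋) − Σ_{k ≤ K}(μ(k)/k)·(S(⌊N/k⌋) − S(K))`.**

The analytic half (L3b) inserts the tree's Goldston–Yıldırım bound `m_p(R) ≪ e^{−c√log R}` (`p ≤ R`,
`…goldstonYildirim_lemma21_j0_holds`) in the first sum and `S(x) = ½log²x + κ + O(log⁻ⁿ)` (`…DiagRemP2MertensLogSq`), `m`, `M₁`,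
`R₂ = 2 log + ρ` (`…DiagRemP2RieszTwo`) in the second: `Σ_{d ≤ y} μ(d)P₂(d)/d = −log y − ρ/2 + O((log y)⁻ⁿ)`.

Def-free; theorems only; elementary. Helper `--supports stmt-Parity-20007`; closes nothing; K_A, K_B and the Parity summit are
NOT proved; nothing about Landau–Siegel zeros.

## References
* G. H. Hardy, E. M. Wright, *An Introduction to the Theory of Numbers*, 6th ed., §22.15 (Selberg's formula, the sums
  `Σ μ(d)/d · log²`). [cite: HardyWright2008, §22.15 — derivation (bookkeeping)]
-/

open Finset Real
open scoped ArithmeticFunction.Moebius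

namespace Summit.Parity.GeneralizedHardyLittlewood.Theorems.MomentsBeyondDiagonal.DiagCorner

/-- `μ(pm)/(pm) = −μ(m)/(pm)·1_{(m,p)=1}` for a prime `p`. [folklore] -/
theorem moebius_prime_mul_div (p m : ℕ) (hp : p.Prime) :
    (ArithmeticFunction.moebius (p * m) : ℝ) / ((p * m : ℕ) : ℝ) =
      if m.Coprime p then -((ArithmeticFunction.moebius m : ℝ) / m) / p else 0 := by
  split_ifs with h
  · have hcop : p.Coprime m := h.symm
    rw [ArithmeticFunction.isMultiplicative_moebius.map_mul_of_coprime hcop,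
      ArithmeticFunction.moebius_apply_prime hp]
    push_cast
    have hp0 : (p : ℝ) ≠ 0 := by exact_mod_cast hp.ne_zero
    rcases Nat.eq_zero_or_pos m with rfl | hm
    · simp
    · have hm0 : (m : ℝ) ≠ 0 := by exact_mod_cast hm.ne'
      field_simp
  · have hdvd : p ∣ m := by
      rwa [Nat.Coprime, Nat.gcd_comm, ← Nat.Prime.dvd_iff_not_coprime hp] at h
    have hns : ¬Squarefree (p * m) := by
      intro hsq
      obtain ⟨k, rfl⟩ := hdvd
      have := hsq p ⟨k, by ring⟩
      exact hp.one_lt.ne' (Nat.isUnit_iff.1 this)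
    rw [ArithmeticFunction.moebius_eq_zero_of_not_squarefree hns]
    simp

/-- **`Σ_{d ≤ N} μ(d)P₂(d)/d = −Σ_{p ≤ N} (log²p/p)·Σ_{m ≤ N/p, (m,p)=1} μ(m)/m`.**
[cite: HardyWright2008, §22.15 — derivation (bookkeeping)] -/
theorem sum_moebius_primeSq_div_eq (N : ℕ) :
    ∑ d ∈ Icc 1 N, (ArithmeticFunction.moebius d : ℝ) / d * ∑ p ∈ d.primeFactors, Real.log p ^ 2 =
      -∑ p ∈ Nat.primesLE N, Real.log p ^ 2 / p *
        ∑ m ∈ (Icc 1 (N / p)).filter (fun m ↦ m.Coprime p), (ArithmeticFunction.moebius m : ℝ) / m := by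
  -- Step 1: the inner index set as a filter of `primesLE N`
  have hinner : ∀ d ∈ Icc 1 N, ∑ p ∈ d.primeFactors, Real.log p ^ 2 =
      ∑ p ∈ Nat.primesLE N, if p ∣ d then Real.log p ^ 2 else 0 := by
    intro d hd
    have hd1 : 1 ≤ d := (Finset.mem_Icc.1 hd).1
    have hdN : d ≤ N := (Finset.mem_Icc.1 hd).2
    rw [← Finset.sum_filter]
    refine Finset.sum_congr ?_ fun _ _ ↦ rfl
    ext p
    simp only [Nat.mem_primeFactors, Finset.mem_filter, Nat.mem_primesLE]
    constructor
    · rintro ⟨hp, hpd, -⟩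
      exact ⟨⟨(Nat.le_of_dvd (by omega) hpd).trans hdN, hp⟩, hpd⟩
    · rintro ⟨⟨-, hp⟩, hpd⟩
      exact ⟨hp, hpd, by omega⟩
  rw [Finset.sum_congr rfl fun d hd ↦ by rw [hinner d hd, Finset.mul_sum], Finset.sum_comm,
    ← Finset.sum_neg_distrib]
  refine Finset.sum_congr rfl fun p hp ↦ ?_
  have hpp : p.Prime := (Nat.mem_primesLE.1 hp).2
  have hp0 : 0 < p := hpp.pos
  -- Step 2: `Σ_d [p ∣ d] μ(d)/d·log²p = log²p · Σ_{m ≤ N/p} μ(pm)/(pm)`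
  rw [show ∑ d ∈ Icc 1 N, (ArithmeticFunction.moebius d : ℝ) / d * (if p ∣ d then Real.log p ^ 2 else 0) =
      ∑ d ∈ (Icc 1 N).filter (fun d ↦ p ∣ d), Real.log p ^ 2 * ((ArithmeticFunction.moebius d : ℝ) / d) by
    rw [Finset.sum_filter]
    refine Finset.sum_congr rfl fun d _ ↦ ?_
    split_ifs <;> ring]
  have himage : (Icc 1 N).filter (fun d ↦ p ∣ d) = (Icc 1 (N / p)).image (fun m ↦ p * m) := by
    ext d
    simp only [Finset.mem_filter, Finset.mem_Icc, Finset.mem_image]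
    constructor
    · rintro ⟨⟨hd1, hdN⟩, ⟨m, rfl⟩⟩
      refine ⟨m, ⟨?_, ?_⟩, rfl⟩
      · rcases Nat.eq_zero_or_pos m with rfl | hm
        · simp at hd1
        · exact hm
      · exact (Nat.le_div_iff_mul_le hp0).2 (by rwa [mul_comm] at hdN)
    · rintro ⟨m, ⟨hm1, hmN⟩, rfl⟩
      refine ⟨⟨?_, ?_⟩, ⟨m, rfl⟩⟩
      · exact Nat.one_le_iff_ne_zero.2 (Nat.mul_ne_zero hpp.ne_zero (by omega))
      · have := (Nat.le_div_iff_mul_le hp0).1 hmN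
        rwa [mul_comm] at this
  rw [himage, Finset.sum_image (fun a _ b _ hab ↦ (Nat.mul_right_inj hpp.ne_zero).1 hab),
    ← Finset.mul_sum, Finset.sum_filter, Finset.mul_sum, Finset.mul_sum, ← Finset.sum_neg_distrib]
  refine Finset.sum_congr rfl fun m _ ↦ ?_
  rw [moebius_prime_mul_div p m hpp]
  have hp0' : (p : ℝ) ≠ 0 := by exact_mod_cast hpp.ne_zero
  split_ifs
  · field_simp
  · simp

/-- For `N/p < p` every `m ≤ N/p` is coprime to the prime `p`. [folklore] -/
theorem filter_coprime_Icc_div_eq {N p : ℕ} (hp : p.Prime) (hNp : N / p < p) :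
    (Icc 1 (N / p)).filter (fun m ↦ m.Coprime p) = Icc 1 (N / p) := by
  refine Finset.filter_true_of_mem fun m hm ↦ ?_
  have hm := Finset.mem_Icc.1 hm
  exact (Nat.coprime_of_lt_prime (by omega) (by omega) hp).symm

/-- `Σ_{p ≤ M, K < p} g(p) = Σ_{p ≤ M} g(p) − Σ_{p ≤ K} g(p)` for `K ≤ M`. [folklore] -/
theorem sum_primesLE_filter_lt_eq (g : ℕ → ℝ) {K M : ℕ} (hKM : K ≤ M) :
    ∑ p ∈ (Nat.primesLE M).filter (fun p ↦ K < p), g p =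
      ∑ p ∈ Nat.primesLE M, g p - ∑ p ∈ Nat.primesLE K, g p := by
  have hsub : (Nat.primesLE M).filter (fun p ↦ ¬K < p) = Nat.primesLE K := by
    ext p
    simp only [Finset.mem_filter, Nat.mem_primesLE, not_lt]
    constructor
    · rintro ⟨⟨-, hp⟩, hpK⟩; exact ⟨hpK, hp⟩
    · rintro ⟨hpK, hp⟩; exact ⟨⟨hpK.trans hKM, hp⟩, hpK⟩
  rw [eq_sub_iff_add_eq, ← hsub, Finset.sum_filter_add_sum_filter_not]

/-- **The large primes, swapped**: for `K² ≤ N < (K+1)²`,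
`Σ_{K < p ≤ N} (log²p/p)·Σ_{k ≤ N/p} μ(k)/k = Σ_{k ≤ K} (μ(k)/k)·(S(N/k) − S(K))`, `S(M) = Σ_{p ≤ M} log²p/p`.
[cite: HardyWright2008, §22.15 — derivation (bookkeeping)] -/
theorem sum_large_primes_swap {N K : ℕ} (hK : K * K ≤ N) (hN : N < (K + 1) * (K + 1)) :
    ∑ p ∈ (Nat.primesLE N).filter (fun p ↦ K < p), Real.log p ^ 2 / p *
        ∑ k ∈ Icc 1 (N / p), (ArithmeticFunction.moebius k : ℝ) / k =
      ∑ k ∈ Icc 1 K, (ArithmeticFunction.moebius k : ℝ) / k *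
        ((∑ p ∈ Nat.primesLE (N / k), Real.log p ^ 2 / p) - ∑ p ∈ Nat.primesLE K, Real.log p ^ 2 / p) := by
  -- the inner range `k ≤ N/p` sits inside `k ≤ K` for `p > K`
  have hrange : ∀ p ∈ (Nat.primesLE N).filter (fun p ↦ K < p),
      ∑ k ∈ Icc 1 (N / p), (ArithmeticFunction.moebius k : ℝ) / k =
        ∑ k ∈ Icc 1 K, if p * k ≤ N then (ArithmeticFunction.moebius k : ℝ) / k else 0 := by
    intro p hp
    have hKp : K < p := (Finset.mem_filter.1 hp).2
    have hp0 : 0 < p := by omega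
    have hNpK : N / p ≤ K := by
      have h1 : N / p < K + 1 := by
        apply Nat.div_lt_of_lt_mul
        calc N < (K + 1) * (K + 1) := hN
          _ ≤ p * (K + 1) := Nat.mul_le_mul_right _ hKp
      omega
    rw [← Finset.sum_filter]
    refine Finset.sum_congr ?_ fun _ _ ↦ rfl
    ext k
    simp only [Finset.mem_Icc, Finset.mem_filter]
    constructor
    · rintro ⟨hk1, hkN⟩
      exact ⟨⟨hk1, hkN.trans hNpK⟩, by rw [mul_comm]; exact (Nat.le_div_iff_mul_le hp0).1 hkN⟩
    · rintro ⟨⟨hk1, -⟩, hpk⟩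
      exact ⟨hk1, (Nat.le_div_iff_mul_le hp0).2 (by rwa [mul_comm] at hpk)⟩
  rw [Finset.sum_congr rfl fun p hp ↦ by rw [hrange p hp, Finset.mul_sum], Finset.sum_comm]
  refine Finset.sum_congr rfl fun k hk ↦ ?_
  have hk1 : 1 ≤ k := (Finset.mem_Icc.1 hk).1
  have hkK : k ≤ K := (Finset.mem_Icc.1 hk).2
  have hk0 : 0 < k := hk1
  -- `K ≤ N/k` for `k ≤ K`
  have hKNk : K ≤ N / k := (Nat.le_div_iff_mul_le hk0).2 ((Nat.mul_le_mul_left K hkK).trans hK)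
  rw [← sum_primesLE_filter_lt_eq _ hKNk, Finset.mul_sum]
  -- both sides are sums over primes `K < p` with `pk ≤ N`
  rw [show ∑ p ∈ (Nat.primesLE N).filter (fun p ↦ K < p),
      Real.log p ^ 2 / p * (if p * k ≤ N then (ArithmeticFunction.moebius k : ℝ) / k else 0) =
      ∑ p ∈ ((Nat.primesLE N).filter (fun p ↦ K < p)).filter (fun p ↦ p * k ≤ N),
        (ArithmeticFunction.moebius k : ℝ) / k * (Real.log p ^ 2 / p) by
    rw [Finset.sum_filter (fun p ↦ p * k ≤ N)]
    refine Finset.sum_congr rfl fun p _ ↦ ?_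
    split_ifs <;> ring]
  refine Finset.sum_congr ?_ fun _ _ ↦ rfl
  ext p
  simp only [Finset.mem_filter, Nat.mem_primesLE]
  constructor
  · rintro ⟨⟨⟨-, hp⟩, hKp⟩, hpk⟩
    exact ⟨⟨(Nat.le_div_iff_mul_le hk0).2 hpk, hp⟩, hKp⟩
  · rintro ⟨⟨hpNk, hp⟩, hKp⟩
    have hpk : p * k ≤ N := (Nat.le_div_iff_mul_le hk0).1 hpNk
    exact ⟨⟨⟨le_trans (Nat.le_mul_of_pos_right p hk0) hpk, hp⟩, hKp⟩, hpk⟩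

/-- **The exact splitting at `K = ⌊√N⌋`**:
`Σ_{d ≤ N} μ(d)P₂(d)/d = −Σ_{p ≤ K}(log²p/p)·m_p(N/p) − Σ_{k ≤ K}(μ(k)/k)·(S(N/k) − S(K))`
(`m_p(Z) = Σ_{m ≤ Z, (m,p)=1} μ(m)/m`, `S(M) = Σ_{p ≤ M} log²p/p`, `K² ≤ N < (K+1)²`).
[cite: HardyWright2008, §22.15 — derivation (bookkeeping)] -/
theorem sum_moebius_primeSq_div_split {N K : ℕ} (hK : K * K ≤ N) (hN : N < (K + 1) * (K + 1)) :
    ∑ d ∈ Icc 1 N, (ArithmeticFunction.moebius d : ℝ) / d * ∑ p ∈ d.primeFactors, Real.log p ^ 2 =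
      -(∑ p ∈ Nat.primesLE K, Real.log p ^ 2 / p *
          ∑ m ∈ (Icc 1 (N / p)).filter (fun m ↦ m.Coprime p), (ArithmeticFunction.moebius m : ℝ) / m) -
        ∑ k ∈ Icc 1 K, (ArithmeticFunction.moebius k : ℝ) / k *
          ((∑ p ∈ Nat.primesLE (N / k), Real.log p ^ 2 / p) - ∑ p ∈ Nat.primesLE K, Real.log p ^ 2 / p) := by
  have hKN : K ≤ N := by nlinarith
  rw [sum_moebius_primeSq_div_eq, ← sum_large_primes_swap hK hN,
    ← Finset.sum_filter_add_sum_filter_not (Nat.primesLE N) (fun p ↦ K < p)]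
  have hsub : (Nat.primesLE N).filter (fun p ↦ ¬K < p) = Nat.primesLE K := by
    ext p
    simp only [Finset.mem_filter, Nat.mem_primesLE, not_lt]
    constructor
    · rintro ⟨⟨-, hp⟩, hpK⟩; exact ⟨hpK, hp⟩
    · rintro ⟨hpK, hp⟩; exact ⟨⟨hpK.trans hKN, hp⟩, hpK⟩
  have hbig : ∑ p ∈ (Nat.primesLE N).filter (fun p ↦ K < p), Real.log p ^ 2 / p *
        ∑ m ∈ (Icc 1 (N / p)).filter (fun m ↦ m.Coprime p), (ArithmeticFunction.moebius m : ℝ) / m =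
      ∑ p ∈ (Nat.primesLE N).filter (fun p ↦ K < p), Real.log p ^ 2 / p *
        ∑ k ∈ Icc 1 (N / p), (ArithmeticFunction.moebius k : ℝ) / k := by
    refine Finset.sum_congr rfl fun p hp ↦ ?_
    have hKp : K < p := (Finset.mem_filter.1 hp).2
    have hpp : p.Prime := (Nat.mem_primesLE.1 (Finset.mem_filter.1 hp).1).2
    have hNp : N / p < p := by
      apply Nat.div_lt_of_lt_mul
      calc N < (K + 1) * (K + 1) := hN
        _ ≤ p * p := Nat.mul_le_mul hKp hKp
    rw [filter_coprime_Icc_div_eq hpp hNp]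
  rw [hsub, hbig]
  ring

end Summit.Parity.GeneralizedHardyLittlewood.Theorems.MomentsBeyondDiagonal.DiagCorner
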